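/-
Origin: expansion seat `planner-pub-hodgecm-toy2-g5-0`, handover #1 2026-08-18T08:46:35Z (`HOME/pub-hodgecm-toy2-g5/lean/Toy2g5/PadH0.lean`, md5 4cd87623, 972 lines);
landed by the gen-7 packager in gate run 27 as `HodgeCM/Model/PadH0.lean` (verbatim).
-/
/-
Copyright: pub-hodgecm formalisation cell (harness21, 2026). New file (not vendored).
Origin: HOME/pub-hodgecm-toy2-g5/lean/Toy2g5/PadH0.lean — session planner-pub-hodgecm-toy2-g5-0 (unit pub-hodgecm-toy2-g5,
CONSISTENCY seat 2, part (6a)(ii), generation 5).  WIP module `Toy2g5.PadH0`; intended final place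
`HodgeCM/Model/PadH0.lean` (module `HodgeCM.Model.PadH0`; kind L5 consistency / non-vacuity layer).  Imports are FINAL
package names; nothing to rewrite.  Architecture after `HodgeCM.Model.PadH6` (toy2-g4).
-/
import Summits.HodgeConjecture.HodgeCM.Geometry.CupFacts
import Summits.HodgeConjecture.HodgeCM.StubTree.Qw8Geometric
import Summits.HodgeConjecture.HodgeCM.StubTree.Inputs
import Summits.HodgeConjecture.HodgeCM.Model.Inhabited
import Summits.HodgeConjecture.HodgeCM.StubTree.Qw8Monomial_3

/-!
# Padding `H⁰`: degree-zero universe transforms (separating models for N3 `Fact_pull_H0` and N4 `Fact_hodge_F0`)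

For ANY geometric universe `U` (the signature `HodgeCM.Universe`) and any **pad datum** `D` on it — a contravariant
assignment `X ↦ P(X)` of finite-dimensional `ℚ`-vector spaces with a weight-`0` Hodge structure and `ℚ`-linear maps
`P(f) : P(Y) → P(X)` for `f : X → Y` — let `U♭ := U.padH0 D` be the universe with the SAME varieties, dimensions,
morphisms, products, CM abelian varieties, CM actions and Picard modular surfaces, the same cohomology `H^k(X, ℚ)` with its
Hodge structure, algebraic classes, pull-backs, cup products and traces in every degree `k ≥ 1` — DEFINITIONALLY, through
the degree-zero pad combinator `HodgeCM.PadZero.Pad` (two patterns: `Pad 0 A B = A × B`, `Pad (n+1) A B = A`, so that every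
statement of the theory living in degrees `1, 2, 4, 2p+2, k+1, …` holds in `U♭` by the very same proof term) — and in
degree zero

  `H♭⁰(X) := H⁰(X, ℚ) ⊕ P(X)`   (the "pad"),

with: pull-backs `f^* ⊕ P(f)`; the Hodge structure `H⁰(X) ⊕ (P(X), D.hs X)`; algebraic classes `Alg⁰(X) ⊕ 0`; every cup
product read through the first summand and landing in the first summand (the pad is a square-zero, cup-orthogonal ideal);
traces through the first summand.

## Results (no hypothesis on `U` beyond the ones named; nothing cited; Lean + Mathlib axioms only)

* §0 `PadZero`: the combinator, its instances and structure maps `fst`, `snd`, `inl`, `inr`, `map`, `sub`, `hodge`, and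
  their (two-case) lemmas; helper lemmas on complexifications (`prodEquiv_apply`, `baseChange_ofRat`, `ofRat_injective`, …).
* §1 `Universe.PadDatum`, its laws `PadDatum.Laws` (functoriality, Hodge compatibility, and triviality of the pad action
  of ONE domination witness per CM abelian variety), the transform `Universe.padH0`; §2 its API (`toU = fst`, `padOf = snd`,
  `ofU = inl`, `ofPad = inr`; transport of `pull`, `cup`, `tr`, `alg`, `castCoh`, the Hodge filtrations `mem_F_iff`,
  complexifications `toUC`, `padOfC`, `ofUC`).
* §3 transport of the composite notions (`isDiagAct_toU`, `dim_prod4`, `cupPow_eq`, weight vectors componentwise).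
* §4 **`PadH0.modelAxioms (M : U.ModelAxioms) (hd : U.Fact_dimProd) (hD : D.Laws) : (U.padH0 D).ModelAxioms`** — all 28
  model facts survive (`Fact_dimProd`, with M11, is used for M28 only: it puts the source degree `2(dim P - 2) = 8g - 4` of
  the algebraic self-duality off the padded degree `0`).
* §5 N1 `Fact_cupExterior` (`Iff`), N2 `Fact_cup_hodge`, F4 `Fact_cupAlg`, F5 `Fact_cupAssoc`, `Fact_dimProd` (`Iff`),
  `W_RK4` (`Iff`), `RealisationExistsFace/PerL`, `HC_CM` (given that the pad carries no nonzero rational Hodge class)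
  transfer; N3 transfers iff the pad action of endomorphisms is trivial, N4 iff the pad structures have `F⁰ = ⊤`;
  Pohlmann's span inclusion transfers when the pad carries no nonzero rational Hodge class (`pohlmannSpan_of_padHodge`).

The two data of interest and the separation theorems are in `HodgeCM.Model.PadH0J` (datum A: `P = H⁰ ⊕ H⁰` with a
GL-natural NON-EFFECTIVE weight-0 structure — N4 fails) and `HodgeCM.Model.PadH0Two` (datum B: `P = H²` purely of type
`(0,0)` with `P(f) = f^*|_{H²}` — N3 and `PohlmannSpan` fail); unconditional instances on `toyModel` in
`HodgeCM.Model.Toy.ToyPadH0J` and `HodgeCM.Model.Toy.ToyPadH0Two`.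
No print meaning is claimed for `U♭` (it is not the cohomology of anything); it is a consistency / independence device for
the axiom system, like the exterior toy universe, `truncAlg`, `killH0` and `padH6`.
-/

noncomputable section

open scoped TensorProduct

namespace HodgeCM

open Literature.AlgebraicGeometry.Motives (CMType HodgeStructure)
open Literature.AlgebraicGeometry.Motives.HodgeStructure (EndAction ofRat conj complexConj prodEquiv pureFiltration)

/-! ## 0. The degree-zero pad combinator -/

namespace PadZero

/-- `Pad k A B`: the module `A × B` in degree `k = 0` and `A` in every other degree — by pattern matching, so that
`Pad 1 A B`, `Pad (2 * 2) A B`, `Pad (k + 1) A B` all reduce to `A` definitionally. -/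
@[reducible] def Pad : ℕ → Type → Type → Type
  | 0, A, B => A × B
  | _ + 1, A, _ => A

section Inst

variable (A B : Type) [AddCommGroup A] [AddCommGroup B] [Module ℚ A] [Module ℚ B]

/-- (Ported verbatim from the HodgeCMPerL package; no docstring in the source.) -/
@[reducible] instance instAddCommGroup : (k : ℕ) → AddCommGroup (Pad k A B)
  | 0 => inferInstanceAs (AddCommGroup (A × B))
  | _ + 1 => inferInstanceAs (AddCommGroup A)

/-- (Ported verbatim from the HodgeCMPerL package; no docstring in the source.) -/
@[reducible] instance instModule : (k : ℕ) → Module ℚ (Pad k A B)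
  | 0 => inferInstanceAs (Module ℚ (A × B))
  | _ + 1 => inferInstanceAs (Module ℚ A)

/-- (Ported verbatim from the HodgeCMPerL package; no docstring in the source.) -/
instance instFinite [Module.Finite ℚ A] [Module.Finite ℚ B] : (k : ℕ) → Module.Finite ℚ (Pad k A B)
  | 0 => inferInstanceAs (Module.Finite ℚ (A × B))
  | _ + 1 => inferInstanceAs (Module.Finite ℚ A)

/-- The first projection `Pad k A B → A` (`Prod.fst` in degree `0`, the identity otherwise). -/
def fst : (k : ℕ) → Pad k A B →ₗ[ℚ] A
  | 0 => LinearMap.fst ℚ A B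
  | _ + 1 => LinearMap.id

/-- The pad projection `Pad k A B → B` (`Prod.snd` in degree `0`, zero otherwise). -/
def snd : (k : ℕ) → Pad k A B →ₗ[ℚ] B
  | 0 => LinearMap.snd ℚ A B
  | _ + 1 => 0

/-- The first inclusion `A → Pad k A B` (`(a, 0)` in degree `0`, the identity otherwise). -/
def inl : (k : ℕ) → A →ₗ[ℚ] Pad k A B
  | 0 => LinearMap.inl ℚ A B
  | _ + 1 => LinearMap.id

/-- The pad inclusion `B → Pad k A B` (`(0, b)` in degree `0`, zero otherwise). -/
def inr : (k : ℕ) → B →ₗ[ℚ] Pad k A B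
  | 0 => LinearMap.inr ℚ A B
  | _ + 1 => 0

/-- A submodule of `A` as a submodule of `Pad k A B` (`S × 0` in degree `0`, `S` otherwise). -/
def sub : (k : ℕ) → Submodule ℚ A → Submodule ℚ (Pad k A B)
  | 0, S => S.prod ⊥
  | _ + 1, S => S

/-- Two Hodge structures, of weight `k` on `A` and of weight `0` on `B`, as one on `Pad k A B` (their direct sum in
degree `0`, the first one otherwise). -/
def hodge : (k : ℕ) → HodgeStructure A (k : ℤ) → HodgeStructure B ((0 : ℕ) : ℤ) → HodgeStructure (Pad k A B) (k : ℤ)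
  | 0, H₁, H₂ => H₁.prod H₂
  | _ + 1, H₁, _ => H₁

end Inst

section Map

variable {A A' A'' B B' B'' : Type} [AddCommGroup A] [AddCommGroup B] [Module ℚ A] [Module ℚ B]
  [AddCommGroup A'] [AddCommGroup B'] [Module ℚ A'] [Module ℚ B']
  [AddCommGroup A''] [AddCommGroup B''] [Module ℚ A''] [Module ℚ B'']

/-- Functoriality of `Pad k`: `f × g` in degree `0`, `f` otherwise. -/
def map : (k : ℕ) → (A →ₗ[ℚ] A') → (B →ₗ[ℚ] B') → (Pad k A B →ₗ[ℚ] Pad k A' B')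
  | 0, f, g => LinearMap.prodMap f g
  | _ + 1, f, _ => f

/-- (Ported verbatim from the HodgeCMPerL package; no docstring in the source.) -/
theorem fst_map (k : ℕ) (f : A →ₗ[ℚ] A') (g : B →ₗ[ℚ] B') (x : Pad k A B) :
    fst A' B' k (map k f g x) = f (fst A B k x) := by
  rcases k with _|k <;> rfl

/-- (Ported verbatim from the HodgeCMPerL package; no docstring in the source.) -/
theorem snd_map (k : ℕ) (f : A →ₗ[ℚ] A') (g : B →ₗ[ℚ] B') (x : Pad k A B) :
    snd A' B' k (map k f g x) = g (snd A B k x) := by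
  rcases k with _|k
  · rfl
  · exact (map_zero g).symm

/-- (Ported verbatim from the HodgeCMPerL package; no docstring in the source.) -/
theorem map_inl (k : ℕ) (f : A →ₗ[ℚ] A') (g : B →ₗ[ℚ] B') (a : A) :
    map k f g (inl A B k a) = inl A' B' k (f a) := by
  rcases k with _|k
  · exact Prod.ext rfl (map_zero g)
  · rfl

/-- (Ported verbatim from the HodgeCMPerL package; no docstring in the source.) -/
theorem map_inr (k : ℕ) (f : A →ₗ[ℚ] A') (g : B →ₗ[ℚ] B') (b : B) :
    map k f g (inr A B k b) = inr A' B' k (g b) := by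
  rcases k with _|k
  · exact Prod.ext (map_zero f) rfl
  · exact map_zero f

/-- (Ported verbatim from the HodgeCMPerL package; no docstring in the source.) -/
theorem map_id (k : ℕ) : map k (LinearMap.id : A →ₗ[ℚ] A) (LinearMap.id : B →ₗ[ℚ] B) = LinearMap.id := by
  rcases k with _|k
  · exact LinearMap.prodMap_id
  · rfl

/-- (Ported verbatim from the HodgeCMPerL package; no docstring in the source.) -/
theorem map_comp (k : ℕ) (f : A →ₗ[ℚ] A') (f' : A' →ₗ[ℚ] A'') (g : B →ₗ[ℚ] B') (g' : B' →ₗ[ℚ] B'') :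
    map k (f' ∘ₗ f) (g' ∘ₗ g) = map k f' g' ∘ₗ map k f g := by
  rcases k with _|k
  · exact (LinearMap.prodMap_comp f f' g g').symm
  · rfl

end Map

section Lemmas

variable {A B : Type} [AddCommGroup A] [AddCommGroup B] [Module ℚ A] [Module ℚ B]

/-- (Ported verbatim from the HodgeCMPerL package; no docstring in the source.) -/
theorem fst_inl (k : ℕ) (a : A) : fst A B k (inl A B k a) = a := by
  rcases k with _|k <;> rfl

/-- (Ported verbatim from the HodgeCMPerL package; no docstring in the source.) -/
theorem snd_inl (k : ℕ) (a : A) : snd A B k (inl A B k a) = 0 := by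
  rcases k with _|k <;> rfl

/-- (Ported verbatim from the HodgeCMPerL package; no docstring in the source.) -/
theorem fst_inr (k : ℕ) (b : B) : fst A B k (inr A B k b) = 0 := by
  rcases k with _|k <;> rfl

/-- (Ported verbatim from the HodgeCMPerL package; no docstring in the source.) -/
theorem inl_fst_add_inr_snd (k : ℕ) (x : Pad k A B) : inl A B k (fst A B k x) + inr A B k (snd A B k x) = x := by
  rcases k with _|k
  · exact Prod.ext (add_zero _) (zero_add _)
  · exact add_zero _

/-- Off degree `0` the pad vanishes and `inl ∘ fst = id`. -/
theorem inl_fst_of_ne {k : ℕ} (hk : k ≠ 0) (x : Pad k A B) : inl A B k (fst A B k x) = x := by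
  rcases k with _|k
  · exact absurd rfl hk
  · rfl

/-- (Ported verbatim from the HodgeCMPerL package; no docstring in the source.) -/
theorem snd_of_ne {k : ℕ} (hk : k ≠ 0) (x : Pad k A B) : snd A B k x = 0 := by
  rcases k with _|k
  · exact absurd rfl hk
  · rfl

/-- (Ported verbatim from the HodgeCMPerL package; no docstring in the source.) -/
theorem inr_of_ne {k : ℕ} (hk : k ≠ 0) (b : B) : inr A B k b = 0 := by
  rcases k with _|k
  · exact absurd rfl hk
  · rfl

/-- (Ported verbatim from the HodgeCMPerL package; no docstring in the source.) -/
theorem ext_iff' (k : ℕ) (x y : Pad k A B) : x = y ↔ fst A B k x = fst A B k y ∧ snd A B k x = snd A B k y := by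
  constructor
  · rintro rfl; exact ⟨rfl, rfl⟩
  · rintro ⟨h1, h2⟩
    rw [← inl_fst_add_inr_snd k x, ← inl_fst_add_inr_snd k y, h1, h2]

/-- (Ported verbatim from the HodgeCMPerL package; no docstring in the source.) -/
theorem fst_injective_of_ne {k : ℕ} (hk : k ≠ 0) : Function.Injective (fst A B k) := fun x y h => by
  rw [← inl_fst_of_ne hk x, ← inl_fst_of_ne hk y, h]

/-- (Ported verbatim from the HodgeCMPerL package; no docstring in the source.) -/
theorem fst_bijective_of_ne {k : ℕ} (hk : k ≠ 0) : Function.Bijective (fst A B k) :=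
  ⟨fst_injective_of_ne hk, fun a => ⟨inl A B k a, fst_inl k a⟩⟩

/-- (Ported verbatim from the HodgeCMPerL package; no docstring in the source.) -/
theorem inl_injective (k : ℕ) : Function.Injective (inl A B k) := fun a b h => by
  rw [← fst_inl (B := B) k a, ← fst_inl (B := B) k b, h]

/-- (Ported verbatim from the HodgeCMPerL package; no docstring in the source.) -/
theorem mem_sub_iff (k : ℕ) (S : Submodule ℚ A) (x : Pad k A B) :
    x ∈ sub A B k S ↔ fst A B k x ∈ S ∧ snd A B k x = 0 := by
  rcases k with _|k
  · exact Submodule.mem_prod.trans (and_congr Iff.rfl (Submodule.mem_bot ℚ))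
  · exact ⟨fun h => ⟨h, rfl⟩, fun h => h.1⟩

/-! ### Complexification of the structure maps -/

/-- `prodEquiv` is `(fst ⊗ ℂ, snd ⊗ ℂ)`. -/
theorem prodEquiv_apply (x : ℂ ⊗[ℚ] (A × B)) :
    prodEquiv A B x = ((LinearMap.fst ℚ A B).baseChange ℂ x, (LinearMap.snd ℚ A B).baseChange ℂ x) := by
  induction x using TensorProduct.induction_on with
  | zero => rw [map_zero, map_zero, map_zero]; rfl
  | tmul c v => simp [prodEquiv]
  | add x y hx hy => rw [map_add, hx, hy, map_add, map_add, Prod.mk_add_mk]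

/-- (Ported verbatim from the HodgeCMPerL package; no docstring in the source.) -/
theorem baseChange_ofRat {M N : Type} [AddCommGroup M] [Module ℚ M] [AddCommGroup N] [Module ℚ N]
    (f : M →ₗ[ℚ] N) (m : M) : f.baseChange ℂ (ofRat m) = ofRat (f m) := by
  rw [HodgeStructure.ofRat_apply, HodgeStructure.ofRat_apply, LinearMap.baseChange_tmul]

/-- `ofRat : M → ℂ ⊗ M` is injective (`ℂ` is flat — indeed free — over `ℚ`). -/
theorem ofRat_injective {M : Type} [AddCommGroup M] [Module ℚ M] : Function.Injective (ofRat : M →ₗ[ℚ] ℂ ⊗[ℚ] M) := by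
  have h := (Module.Flat.rTensor_preserves_injective_linearMap (M := M) (Algebra.linearMap ℚ ℂ)
    (algebraMap ℚ ℂ).injective).comp (TensorProduct.lid ℚ M).symm.injective
  convert h using 1
  ext v
  simp [HodgeStructure.ofRat_apply]

/-- A `ℂ`-subspace of `ℂ ⊗ M` containing all rational vectors is everything. -/
theorem eq_top_of_forall_ofRat_mem {M : Type} [AddCommGroup M] [Module ℚ M] {W : Submodule ℂ (ℂ ⊗[ℚ] M)}
    (h : ∀ m : M, ofRat m ∈ W) : W = ⊤ := by
  refine Submodule.eq_top_iff'.mpr fun z => ?_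
  induction z using TensorProduct.induction_on with
  | zero => exact W.zero_mem
  | tmul c m =>
    have : c ⊗ₜ[ℚ] m = c • ofRat m := by
      rw [HodgeStructure.ofRat_apply, TensorProduct.smul_tmul', smul_eq_mul, mul_one]
    rw [this]
    exact W.smul_mem c (h m)
  | add x y hx hy => exact W.add_mem hx hy

/-- `ℂ ⊗ M = 0` forces `M = 0` (and conversely). -/
theorem forall_eq_zero_iff {M : Type} [AddCommGroup M] [Module ℚ M] :
    (∀ z : ℂ ⊗[ℚ] M, z = 0) ↔ ∀ m : M, m = 0 := by
  constructor
  · intro h m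
    exact ofRat_injective ((h (ofRat m)).trans (map_zero _).symm)
  · intro h z
    induction z using TensorProduct.induction_on with
    | zero => rfl
    | tmul c v => rw [h v, TensorProduct.tmul_zero]
    | add x y hx hy => rw [hx, hy, add_zero]

/-- Membership in the Hodge filtration of a direct sum, componentwise. -/
theorem mem_prod_F_iff {n : ℤ} (H₁ : HodgeStructure A n) (H₂ : HodgeStructure B n) (p : ℤ) (x : ℂ ⊗[ℚ] (A × B)) :
    x ∈ (H₁.prod H₂).F p ↔
      (LinearMap.fst ℚ A B).baseChange ℂ x ∈ H₁.F p ∧ (LinearMap.snd ℚ A B).baseChange ℂ x ∈ H₂.F p := by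
  show prodEquiv A B x ∈ (H₁.F p).prod (H₂.F p) ↔ _
  rw [prodEquiv_apply, Submodule.mem_prod]

/-- Membership in the Hodge filtration of `PadZero.hodge`, componentwise (the pad condition is vacuous off degree `0`). -/
theorem mem_hodge_F_iff (k : ℕ) (H₁ : HodgeStructure A (k : ℤ)) (H₂ : HodgeStructure B ((0 : ℕ) : ℤ)) (p : ℤ)
    (x : ℂ ⊗[ℚ] Pad k A B) :
    x ∈ (hodge A B k H₁ H₂).F p ↔ (fst A B k).baseChange ℂ x ∈ H₁.F p ∧ (snd A B k).baseChange ℂ x ∈ H₂.F p := by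
  rcases k with _|k
  · exact mem_prod_F_iff H₁ H₂ p x
  · rw [show fst A B _ = LinearMap.id from rfl, show snd A B _ = 0 from rfl, LinearMap.baseChange_id,
      LinearMap.baseChange_zero, LinearMap.zero_apply, LinearMap.id_apply]
    exact (and_iff_left (Submodule.zero_mem _)).symm

/-- A linear map preserves the one-step filtrations `pureFiltration _ k` (each is `⊤` or `⊥`). -/
theorem map_mem_pureFiltration {V W : Type} [AddCommGroup V] [Module ℚ V] [AddCommGroup W] [Module ℚ W]
    (g : ℂ ⊗[ℚ] V →ₗ[ℂ] ℂ ⊗[ℚ] W) (k p : ℤ) {x : ℂ ⊗[ℚ] V} (hx : x ∈ pureFiltration V k p) :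
    g x ∈ pureFiltration W k p := by
  by_cases h : p ≤ k
  · rw [HodgeStructure.pureFiltration_of_le h]; exact Submodule.mem_top
  · rw [HodgeStructure.pureFiltration_of_lt (not_le.mp h)] at hx ⊢
    rw [(Submodule.mem_bot ℂ).mp hx, map_zero]
    exact Submodule.zero_mem _

end Lemmas

end PadZero

/-! ## 1. Pad data and the transform `U ↦ U♭ = U.padH0 D` -/

namespace Universe

variable (U : Universe)

/-- **A pad datum** on `U`: finite-dimensional `ℚ`-vector spaces `P(X)` with a weight-`0` Hodge structure and a
contravariant action `P(f) : P(Y) → P(X)` of the morphisms `f : X → Y` (its laws are `PadDatum.Laws`, kept apart so that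
the transform itself is total). -/
structure PadDatum where
  /-- the pad `P(X)` adjoined to `H⁰(X, ℚ)` -/
  P : U.Var → Type
  [instAddCommGroup : ∀ X, AddCommGroup (P X)]
  [instModule : ∀ X, Module ℚ (P X)]
  [instFinite : ∀ X, Module.Finite ℚ (P X)]
  /-- its Hodge structure, of weight `0` -/
  hs : ∀ X, HodgeStructure (P X) ((0 : ℕ) : ℤ)
  /-- the pad action of a morphism (contravariant) -/
  map : ∀ {X Y : U.Var}, U.Mor X Y → (P Y →ₗ[ℚ] P X)

attribute [instance] PadDatum.instAddCommGroup PadDatum.instModule PadDatum.instFinite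

variable {U} in
/-- **The laws of a pad datum** used by `PadH0.modelAxioms`: functoriality (M1, M2), compatibility with the Hodge
filtrations (M3), and, for every CM abelian variety `X`, ONE domination witness `s : X → A′`, `π : A′ → X` of `U` in the
sense of M14 `Fact_cmDominated` whose composite acts TRIVIALLY on the pad (so that `(π ∘ s)^* = N⁰ = 1` on `H♭⁰(X)`). -/
structure PadDatum.Laws (D : U.PadDatum) : Prop where
  map_id : ∀ X : U.Var, D.map (U.idMor X) = LinearMap.id
  map_comp : ∀ (X Y Z : U.Var) (f : U.Mor X Y) (g : U.Mor Y Z), D.map (U.comp f g) = D.map f ∘ₗ D.map g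
  map_hodge : ∀ (X Y : U.Var) (f : U.Mor X Y) (p : ℤ), ((D.hs Y).F p).map ((D.map f).baseChange ℂ) ≤ (D.hs X).F p
  dominated : ∀ X : U.Var, U.IsCMAbelianVariety X →
    ∃ F : CMField, IsGalois ℚ F ∧ 6 ≤ Module.finrank ℚ F ∧
      ∃ (n : ℕ) (Θ : Fin (n + 1) → CMType F) (s : U.Mor X (U.cmProd F Θ)) (π : U.Mor (U.cmProd F Θ) X) (N : ℕ),
        N ≠ 0 ∧ (∀ k : ℕ, U.pull (U.comp s π) k = ((N : ℚ) ^ k) • LinearMap.id) ∧ D.map (U.comp s π) = LinearMap.id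

/-- **The padded universe `U♭ = U.padH0 D`**: same varieties, morphisms, products, CM data and Picard modular surfaces; same
cohomology in every degree `≥ 1` (definitionally); `H♭⁰(X) = H⁰(X) ⊕ P(X)` with pull-backs `f^* ⊕ P(f)`, the Hodge structure
`H⁰(X) ⊕ (P(X), D.hs X)`, no new algebraic classes, cup products and traces through the first summand. -/
@[reducible] def padH0 (D : U.PadDatum) : Universe :=
  { U with
    Coh := fun X k => PadZero.Pad k (U.Coh X k) (D.P X)
    instAddCommGroup := fun X k => PadZero.instAddCommGroup (U.Coh X k) (D.P X) k
    instModule := fun X k => PadZero.instModule (U.Coh X k) (D.P X) k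
    instFinite := fun X k => PadZero.instFinite (U.Coh X k) (D.P X) k
    hodge := fun X k => PadZero.hodge (U.Coh X k) (D.P X) k (U.hodge X k) (D.hs X)
    alg := fun X p => PadZero.sub (U.Coh X (2 * p)) (D.P X) (2 * p) (U.alg X p)
    pull := fun f k => PadZero.map k (U.pull f k) (D.map f)
    cup := fun X i j =>
      LinearMap.compr₂ ((U.cup X i j).compl₁₂ (PadZero.fst (U.Coh X i) (D.P X) i) (PadZero.fst (U.Coh X j) (D.P X) j))
        (PadZero.inl (U.Coh X (i + j)) (D.P X) (i + j))
    tr := fun X k => U.tr X k ∘ₗ PadZero.fst (U.Coh X k) (D.P X) k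
    cmAct := fun K Φ => U.cmAct K Φ }

/-! ## 2. API: the two summands -/

namespace PadH0

variable {U} (D : U.PadDatum)

/-- the geometric summand `H♭^k(X) → H^k(X)` (the identity off degree `0`) -/
def toU (X : U.Var) (k : ℕ) : (U.padH0 D).Coh X k →ₗ[ℚ] U.Coh X k := PadZero.fst (U.Coh X k) (D.P X) k

/-- the pad component `H♭^k(X) → P(X)` (zero off degree `0`) -/
def padOf (X : U.Var) (k : ℕ) : (U.padH0 D).Coh X k →ₗ[ℚ] D.P X := PadZero.snd (U.Coh X k) (D.P X) k


-- port_pkg: scope closed for this part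
end PadH0
end Universe
end HodgeCM
end
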